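import Literature.Probability.RandomPlanarGeometry.HexSAWSurfaceWallRenewalSlackTwoClassification
import HarnessLib

/-!
# Two down steps at any slack: the `2j + k − 1` explicit irreducible blocks of length `6k + 2j` with `k` visits and
two down steps

For the self-avoiding walk on the honeycomb lattice (brick-wall frame) in the half-plane `Y ≤ 0`, an IRREDUCIBLE
POSITIVE WALL
BRIDGE `ω ∈ ipwb n` with `v = visits n ω` surface visits satisfies the six-step law `6v ≤ n`
(`HexSAWSurfaceWallRenewalSixStep`); a
block of length `6k + 2j` with `k` visits has SLACK `2j`.  The lowest vertical stratum of every slack — the blocks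
with exactly TWO
down steps — was classified at slack two (`HexSAWSurfaceWallRenewalSlackTwoClassification`: `k + 1` blocks of profile
`D D U U`) and is
the subject of the slack-four census; this module constructs it at EVERY slack `2j ≥ 2` at once (length symbolic,
`hm : m = 6 * k + 2 * j`, `k ≥ 2`, `j ≥ 1`): three explicit families with together `2j + k − 1` members, each an
irreducible
positive wall bridge with `k` visits and two down steps, pairwise distinct — hence the LOWER BOUND `2j + k − 1` for
the two-down
stratum at slack `2j` (`k + 1, k + 3, k + 5, …`; the matching upper bound, i.e. the classification, is not part of
this module).

Writing a two-down block as `R^p D h₁^a D h₂^b U h₃^c U R^f` (one body of profile `D D U U`; `h₁ h₂ h₃ ∈ {L, R}` the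
directions of
the runs on rows `−1, −2, −1`), the families are, by direction word:
* §1, `R R L` — the O blocks `s2o k j i` (`0 ≤ i ≤ j − 2`): `R D R^{2i+1} D R^{2k+2j−4−2i} U L^{2k−1} U R^{2k−1}`,
dive at column `1`,
  end column `2k + 2j − 2`: `j − 1` blocks;
* §2, `L R L` — the T blocks `s2t k j a` (`1 ≤ a ≤ k − 1`): `R^{2a+1} D L^{2a−1} D R^{2k+2j−2} U L^{2k−2a−1} U
R^{2k−2a−1}`, end column
  `2k + 2j`: `k − 1` blocks;
* §3, `L R R` — the H blocks `s2h k j i` (`0 ≤ i ≤ j`): `R^{2k−1} D L^{2k−3} D R^{2k−2+2i} U R^{2j+1−2i} U R`, end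
column `2k + 2j + 2`:
  `j + 1` blocks;
each with its coordinate facts, membership `∈ ipwb m`, `visits = k` and the two down times (`s2o_mem_ipwb`,
`visits_s2o`,
`stepsD_s2o`, …, `stepsD_s2h`);
* §4, they are pairwise distinct (`twoDownBlocksS k j`, ★ `card_twoDownBlocksS : # = 2j + k − 1`), lie in the stratum
(`twoDownBlocksS_subset`) and give ★ `le_card_filter_visits_two_down : 2j + k − 1 ≤ #{ω ∈ ipwb (6k+2j) : visits = k,
#down = 2}`.

PROOF.  Table walks over `Tab.walk` (`HexSAWSurfaceFourthOrderLower`) with five affine pieces each; the facts, the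
non-renewal
witnesses (`mem_ipwb_of_facts_wit`: the initial wall run is shielded by the later return to column `2`, the final wall
run by the
earlier far end of the bottom run), the visit counts along the two wall runs (`visits_add_of_wall`,
`visits_add_eq_left`) and the down
times are linear arithmetic on the pieces; distinct members differ at one named time or in their end column.

STATUS: lane theorem of the a-idea-1 bridge/renewal lineage (cars 71 `…SixStep`, 73 `…SixStepRigid`, 74a
`…SlackTwoFamilies`, 74b
`…SlackTwoClassification`, 77 `…SlackFourTwoDown`).  OURS (new in writing, modest): the three families at general
slack and the
lower bound `2j + k − 1`; at `j = 2` they are car 77's O, T, H blocks (`1 + (k − 1) + 3 = k + 3`), at `j = 1` the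
two-down blocks of the
slack-two classification (`0 + (k − 1) + 2 = k + 1`).  Checked against the author's enumeration of all irreducible
positive wall bridges
of length `n ≤ 24` from the definitions (`#ipwb(n)` = 1, 0, 1, 1, 3, 7, 18, 49, 133, 373, 1 066, 3 078, the lane's
census): for every
`(k, j)` with `6k + 2j ≤ 24` the two-down stratum consists of EXACTLY these `2j + k − 1` words (`k ≥ 2`, `j ≥ 1`; e.g.
`9` of the `99`
blocks of length `20` with `2` visits, `8` of the `132` blocks of length `24` with `3` visits), so the lower bound is
expected to be the
count; the elementary classification argument (directions `R L ?`, `L L ?` impossible, `R R R` only for `k = 1`, then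
shielding pins
`p`, `f` and the run lengths) is recorded in the lane memo «TWO DOWN, ANY SLACK» and left to a sequel.  The printed
sources carry the
renewal / irreducible-bridge structure (Madras–Slade §1.2, Definition 1.2.4 (bridges, p. 11); §4.2, Definition 4.2.1
(irreducible
bridges, p. 90); Kesten), the brickwork frame of the honeycomb lattice (Enting–Jensen §7.4.2, Fig. 7.10) and the
surface-visit
statistic (Beaton et al. §3.1) — none states these families or the bound.  No `set_option` line is used: every
declaration
elaborates within the default heart-beat budget on the reference farm.
-/

namespace Literature.Probability.RandomPlanarGeometry.SAW.HexBW.Wall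

open Finset Filter Function
open Literature.Probability.LatticeModels Literature.Probability.Percolation SimpleGraph

variable {n : ℕ} {ω : ℕ → Site 2}

/-! ### §0  A private tool -/

/-- The Boolean adjacency test `Eight.adjE` read as a proposition. [cite: EntingJensen2009, §7.4.2, Fig. 7.10
(brickwork form of the honeycomb lattice)] -/
private theorem adjE_iff_tda {a b c d : ℤ} : Eight.adjE a b c d = true ↔
    ((c = a + 1 ∨ a = c + 1) ∧ d = b) ∨ (c = a ∧ ((d = b + 1 ∧ (a + b) % 2 = 0) ∨ (b = d + 1 ∧ (c + d) % 2 = 0))) := by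
  simp [Eight.adjE]

/-! ### §1  Family O (`j − 1` blocks, directions `R R L`): `R D R^{2i+1} D R^{2k+2j−4−2i} U L^{2k−1} U R^{2k−1}` (`0 ≤
i ≤ j − 2`), dive at column `1`, `X_n = 2k + 2j − 2` -/

/-- Column table of the O block with parameter `i` (length `6k+2j`): `(t,0)` for `t ≤ 1`; row `−1` run `(t−1,−1)` out
to column `2i+2` (`t ≤ 2i+3`); bottom run `(t−2,−2)` out to
column `2k+2j−2` (`t ≤ 2k+2j`); return run `(4k+4j−1−t,−1)` back to column `2j−1` (`t ≤ 4k+2j`); final wall run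
`(t−4k−2,0)` out to `2k+2j−2`. [cite: EntingJensen2009, §7.4.2, Fig. 7.10 (brickwork form of the honeycomb lattice)]
-/
def s2oX (k j i t : ℕ) : ℤ :=
  if t ≤ 1 then (t : ℤ)
  else if t ≤ 2 * i + 3 then (t : ℤ) - 1
  else if t ≤ 2 * k + 2 * j then (t : ℤ) - 2
  else if t ≤ 4 * k + 2 * j then 4 * (k : ℤ) + 4 * j - 1 - t
  else (t : ℤ) - 4 * k - 2

/-- Height table of the O blocks. [cite: EntingJensen2009, §7.4.2, Fig. 7.10] -/
def s2oY (k j i t : ℕ) : ℤ :=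
  if t ≤ 1 then 0
  else if t ≤ 2 * i + 3 then -1
  else if t ≤ 2 * k + 2 * j then -2
  else if t ≤ 4 * k + 2 * j then -1
  else 0

/-- **The O block** `(0,0)→(1,0)↓(1,−1)→…→(2i+2,−1)↓(2i+2,−2)→…→(2k+2j−2,−2)↑←…←(2j−1,−1)↑(2j−1,0)→…→(2k+2j−2,0)` of
length `6k+2j`
(`i + 2 ≤ j`; at slack four, `j = 2`, `i = 0`, this is car 77's O block). [cite: EntingJensen2009, §7.4.2, Fig. 7.10] -/
def s2o (k j i : ℕ) : ℕ → Site 2 := Tab.walk (6 * k + 2 * j) (s2oX k j i) (s2oY k j i)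

/-- The five affine pieces of the tables of `s2o`, with their values. [cite: EntingJensen2009, §7.4.2, Fig. 7.10] -/
private theorem s2o_cases (k j i t : ℕ) :
    (t ≤ 1 ∧ s2oX k j i t = (t : ℤ) ∧ s2oY k j i t = 0) ∨
      (2 ≤ t ∧ t ≤ 2 * i + 3 ∧ s2oX k j i t = (t : ℤ) - 1 ∧ s2oY k j i t = -1) ∨
      (2 * i + 4 ≤ t ∧ t ≤ 2 * k + 2 * j ∧ s2oX k j i t = (t : ℤ) - 2 ∧ s2oY k j i t = -2) ∨
      (2 * k + 2 * j + 1 ≤ t ∧ t ≤ 4 * k + 2 * j ∧ s2oX k j i t = 4 * (k : ℤ) + 4 * j - 1 - t ∧ s2oY k j i t = -1) ∨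
      (4 * k + 2 * j + 1 ≤ t ∧ s2oX k j i t = (t : ℤ) - 4 * k - 2 ∧ s2oY k j i t = 0) := by
  simp only [s2oX, s2oY]
  split_ifs <;> omega

/-- **Coordinate facts of `s2o`** (`k ≥ 1`, `i + 2 ≤ j`): brick-wall steps, self-avoidance, lower half-plane, columns in
`[0, X_L]` and `≥ 1` after time `0`, start and end on the wall, even length. [cite: EntingJensen2009, §7.4.2, Fig. 7.10]
[cite: MadrasSlade1993, §1.2, Definition 1.2.4 (bridges, p. 11)] -/
theorem s2o_facts {k j i : ℕ} (hk : 1 ≤ k) (hij : i + 2 ≤ j) : Tab.Facts (6 * k + 2 * j) (s2oX k j i) (s2oY k j i) := by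
  refine ⟨fun t ht => ?_, fun t ht s hs hx hy => ?_, fun t ht => ?_, fun t ht => ?_, ?_, ?_, ?_, by omega,
    fun t ht h1 => ?_⟩
  · rw [adjE_iff_tda]
    rcases s2o_cases k j i t with ⟨h, x, y⟩ | ⟨l, h, x, y⟩ | ⟨l, h, x, y⟩ | ⟨l, h, x, y⟩ | ⟨l, x, y⟩ <;>
      rcases s2o_cases k j i (t + 1) with
        ⟨h', x', y'⟩ | ⟨l', h', x', y'⟩ | ⟨l', h', x', y'⟩ | ⟨l', h', x', y'⟩ | ⟨l', x', y'⟩ <;>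
        omega
  · rcases s2o_cases k j i t with ⟨h, x, y⟩ | ⟨l, h, x, y⟩ | ⟨l, h, x, y⟩ | ⟨l, h, x, y⟩ | ⟨l, x, y⟩ <;>
      rcases s2o_cases k j i s with
        ⟨h', x', y'⟩ | ⟨l', h', x', y'⟩ | ⟨l', h', x', y'⟩ | ⟨l', h', x', y'⟩ | ⟨l', x', y'⟩ <;>
        omega
  · rcases s2o_cases k j i t with ⟨h, x, y⟩ | ⟨l, h, x, y⟩ | ⟨l, h, x, y⟩ | ⟨l, h, x, y⟩ | ⟨l, x, y⟩ <;> omega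
  · have h0 := s2o_cases k j i 0
    have hL := s2o_cases k j i (6 * k + 2 * j)
    rcases s2o_cases k j i t with ⟨h, x, y⟩ | ⟨l, h, x, y⟩ | ⟨l, h, x, y⟩ | ⟨l, h, x, y⟩ | ⟨l, x, y⟩ <;> omega
  · have h0 := s2o_cases k j i 0; omega
  · have h0 := s2o_cases k j i 0; omega
  · have hL := s2o_cases k j i (6 * k + 2 * j); omega
  · rcases s2o_cases k j i t with ⟨h, x, y⟩ | ⟨l, h, x, y⟩ | ⟨l, h, x, y⟩ | ⟨l, h, x, y⟩ | ⟨l, x, y⟩ <;> omega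

/-- `s2o` is a positive wall bridge of length `m = 6k + 2j` (length symbolic). [cite: MadrasSlade1993, §1.2,
Definition 1.2.4 (p. 11)]
[cite: EntingJensen2009, §7.4.2, Fig. 7.10] -/
theorem s2o_mem_pwb {k j i m : ℕ} (hk : 1 ≤ k) (hij : i + 2 ≤ j) (hm : m = 6 * k + 2 * j) : s2o k j i ∈ pwb m :=
  mem_pwb_of_facts rfl (s2o_facts hk hij) hm

/-- Coordinates of `s2o` up to its length. [cite: EntingJensen2009, §7.4.2, Fig. 7.10] -/
theorem s2o_apply {k j i t : ℕ} (ht : t ≤ 6 * k + 2 * j) :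
    s2o k j i t 0 = s2oX k j i t ∧ s2o k j i t 1 = s2oY k j i t :=
  tab_walk_apply ht

/-- **`s2o` is irreducible**: its only interior visits lie on the final wall run (times `t ≥ 4k+2j+2`, columns `≤
2k+2j−3`), after the bottom run reached
column `2k+2j−2` at time `2k+2j`. [cite: MadrasSlade1993, §4.2, Definition 4.2.1 (p. 90)]
[cite: Kesten1963SAW, §4] [cite: EntingJensen2009, §7.4.2, Fig. 7.10] -/
theorem s2o_mem_ipwb {k j i m : ℕ} (hk : 1 ≤ k) (hij : i + 2 ≤ j) (hm : m = 6 * k + 2 * j) : s2o k j i ∈ ipwb m := by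
  refine mem_ipwb_of_facts_wit rfl (s2o_facts hk hij) hm (by omega) fun t ht1 ht2 hte hY => ?_
  rcases s2o_cases k j i t with ⟨h, x, y⟩ | ⟨l, h, x, y⟩ | ⟨l, h, x, y⟩ | ⟨l, h, x, y⟩ | ⟨l, x, y⟩
  · omega
  · omega
  · omega
  · omega
  · refine Or.inr ⟨2 * k + 2 * j, by omega, by omega, ?_⟩
    rcases s2o_cases k j i (2 * k + 2 * j) with
      ⟨h', x', y'⟩ | ⟨l', h', x', y'⟩ | ⟨l', h', x', y'⟩ | ⟨l', h', x', y'⟩ | ⟨l', x', y'⟩ <;>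
      omega

/-- **`s2o` has `k` visits** (all on the final wall run, times `4k+2j+2, …, 6k+2j`).
[cite: BeatonBousquetMelouDeGierDuminilCopinGuttmann2014, §3.1 (arXiv v5 p. 8)] [cite: EntingJensen2009, §7.4.2, Fig.
7.10] -/
theorem visits_s2o {k j i m : ℕ} (hk : 1 ≤ k) (hij : i + 2 ≤ j) (hm : m = 6 * k + 2 * j) :
    visits m (s2o k j i) = k := by
  have hY : ∀ t, t ≤ 6 * k + 2 * j → s2o k j i t 1 = s2oY k j i t := fun t ht => (s2o_apply ht).2
  have h1 : visits (0 + (1)) (s2o k j i) = visits 0 (s2o k j i) + ((0 + (1)) / 2 - 0 / 2) :=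
    visits_add_of_wall fun q _ hq => by
      rw [hY _ (by omega)]
      rcases s2o_cases k j i (0 + q) with
        ⟨h', x', y'⟩ | ⟨l', h', x', y'⟩ | ⟨l', h', x', y'⟩ | ⟨l', h', x', y'⟩ | ⟨l', x', y'⟩ <;> omega
  have h2 : visits (1 + (4 * k + 2 * j - 1)) (s2o k j i) = visits (1) (s2o k j i) :=
    visits_add_eq_left fun q hq1 hq2 h => by
      obtain ⟨-, h0⟩ := h
      rw [hY _ (by omega)] at h0
      rcases s2o_cases k j i (1 + q) with
        ⟨h', x', y'⟩ | ⟨l', h', x', y'⟩ | ⟨l', h', x', y'⟩ | ⟨l', h', x', y'⟩ | ⟨l', x', y'⟩ <;> omega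
  have h3 : visits (4 * k + 2 * j + (2 * k)) (s2o k j i) =
      visits (4 * k + 2 * j) (s2o k j i) + ((4 * k + 2 * j + (2 * k)) / 2 - (4 * k + 2 * j) / 2) :=
    visits_add_of_wall fun q _ hq => by
      rw [hY _ (by omega)]
      rcases s2o_cases k j i (4 * k + 2 * j + q) with
        ⟨h', x', y'⟩ | ⟨l', h', x', y'⟩ | ⟨l', h', x', y'⟩ | ⟨l', h', x', y'⟩ | ⟨l', x', y'⟩ <;>
        omega
  rw [zero_add, visits_zero, zero_add] at h1
  rw [show 1 + (4 * k + 2 * j - 1) = 4 * k + 2 * j by omega, h1] at h2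
  rw [show 4 * k + 2 * j + (2 * k) = 6 * k + 2 * j by omega, h2] at h3
  subst hm
  rw [h3]
  omega

/-- **`s2o` has two down steps**, at the times `1` and `2 * i + 3`. [cite: EntingJensen2009, §7.4.2, Fig. 7.10] -/
theorem stepsD_s2o {k j i m : ℕ} (hk : 1 ≤ k) (hij : i + 2 ≤ j) (hm : m = 6 * k + 2 * j) :
    stepsD m (s2o k j i) = {1, 2 * i + 3} := by
  subst hm
  ext t
  simp only [stepsD, mem_filter, mem_range, mem_insert, mem_singleton]
  constructor
  · rintro ⟨ht, hx, hy⟩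
    rw [(s2o_apply (t := t + 1) (by omega)).1, (s2o_apply (t := t) (by omega)).1] at hx
    rw [(s2o_apply (t := t + 1) (by omega)).2, (s2o_apply (t := t) (by omega)).2] at hy
    rcases s2o_cases k j i t with ⟨h, x, y⟩ | ⟨l, h, x, y⟩ | ⟨l, h, x, y⟩ | ⟨l, h, x, y⟩ | ⟨l, x, y⟩ <;>
      rcases s2o_cases k j i (t + 1) with
        ⟨h', x', y'⟩ | ⟨l', h', x', y'⟩ | ⟨l', h', x', y'⟩ | ⟨l', h', x', y'⟩ | ⟨l', x', y'⟩ <;>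
        omega
  · intro ht
    have ht4 : t + 1 ≤ 6 * k + 2 * j := by omega
    refine ⟨by omega, ?_, ?_⟩
    · rw [(s2o_apply ht4).1, (s2o_apply (t := t) (by omega)).1]
      rcases s2o_cases k j i t with ⟨h, x, y⟩ | ⟨l, h, x, y⟩ | ⟨l, h, x, y⟩ | ⟨l, h, x, y⟩ | ⟨l, x, y⟩ <;>
        rcases s2o_cases k j i (t + 1) with
          ⟨h', x', y'⟩ | ⟨l', h', x', y'⟩ | ⟨l', h', x', y'⟩ | ⟨l', h', x', y'⟩ | ⟨l', x', y'⟩ <;>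
          omega
    · rw [(s2o_apply ht4).2, (s2o_apply (t := t) (by omega)).2]
      rcases s2o_cases k j i t with ⟨h, x, y⟩ | ⟨l, h, x, y⟩ | ⟨l, h, x, y⟩ | ⟨l, h, x, y⟩ | ⟨l, x, y⟩ <;>
        rcases s2o_cases k j i (t + 1) with
          ⟨h', x', y'⟩ | ⟨l', h', x', y'⟩ | ⟨l', h', x', y'⟩ | ⟨l', h', x', y'⟩ | ⟨l', x', y'⟩ <;>
          omega

/-! ### §2  Family T (`k − 1` blocks, directions `L R L`): `R^{2a+1} D L^{2a−1} D R^{2k+2j−2} U L^{2k−2a−1} U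
R^{2k−2a−1}` (`1 ≤ a ≤ k − 1`), `X_n = 2k + 2j` -/

/-- Column table of the T block with hairpin parameter `a` (`1 ≤ a ≤ k−1`, length `6k+2j`): wall run `(t,0)`, `t ≤
2a+1`; return run `(4a+3−t,−1)` back to
column `2`; bottom run `(t−4a,−2)` out to column `2k+2j` (`t ≤ 4a+2k+2j`); return run `(4a+4k+4j+1−t,−1)` back to
column `2a+2j+1`; final wall run
`(t−4k,0)` out to `2k+2j` — the slack-two block F2a with its bottom run `2j − 2` steps longer. [cite:
EntingJensen2009, §7.4.2, Fig. 7.10 (brickwork form of the honeycomb lattice)] -/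
def s2tX (k j a t : ℕ) : ℤ :=
  if t ≤ 2 * a + 1 then (t : ℤ)
  else if t ≤ 4 * a + 1 then 4 * (a : ℤ) + 3 - t
  else if t ≤ 4 * a + 2 * k + 2 * j then (t : ℤ) - 4 * a
  else if t ≤ 2 * a + 4 * k + 2 * j then 4 * (a : ℤ) + 4 * k + 4 * j + 1 - t
  else (t : ℤ) - 4 * k

/-- Height table of the T blocks. [cite: EntingJensen2009, §7.4.2, Fig. 7.10] -/
def s2tY (k j a t : ℕ) : ℤ :=
  if t ≤ 2 * a + 1 then 0
  else if t ≤ 4 * a + 1 then -1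
  else if t ≤ 4 * a + 2 * k + 2 * j then -2
  else if t ≤ 2 * a + 4 * k + 2 * j then -1
  else 0

/-- **The T block** `(0,0)→…→(2a+1,0)↓←…←(2,−1)↓(2,−2)→…→(2k+2j,−2)↑←…←(2a+2j+1,−1)↑(2a+2j+1,0)→…→(2k+2j,0)` of length
`6k+2j`
(`1 ≤ a ≤ k−1`, `j ≥ 1`; car 77's T block at `j = 2`). [cite: EntingJensen2009, §7.4.2, Fig. 7.10] -/
def s2t (k j a : ℕ) : ℕ → Site 2 := Tab.walk (6 * k + 2 * j) (s2tX k j a) (s2tY k j a)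

/-- The five affine pieces of the tables of `s2t`, with their values. [cite: EntingJensen2009, §7.4.2, Fig. 7.10] -/
private theorem s2t_cases (k j a t : ℕ) :
    (t ≤ 2 * a + 1 ∧ s2tX k j a t = (t : ℤ) ∧ s2tY k j a t = 0) ∨
      (2 * a + 2 ≤ t ∧ t ≤ 4 * a + 1 ∧ s2tX k j a t = 4 * (a : ℤ) + 3 - t ∧ s2tY k j a t = -1) ∨
      (4 * a + 2 ≤ t ∧ t ≤ 4 * a + 2 * k + 2 * j ∧ s2tX k j a t = (t : ℤ) - 4 * a ∧ s2tY k j a t = -2) ∨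
      (4 * a + 2 * k + 2 * j + 1 ≤ t ∧ t ≤ 2 * a + 4 * k + 2 * j ∧ s2tX k j a t = 4 * (a : ℤ) + 4 * k + 4 * j + 1 - t ∧
          s2tY k j a t = -1) ∨
      (2 * a + 4 * k + 2 * j + 1 ≤ t ∧ s2tX k j a t = (t : ℤ) - 4 * k ∧ s2tY k j a t = 0) := by
  simp only [s2tX, s2tY]
  split_ifs <;> omega

/-- **Coordinate facts of `s2t`** (`1 ≤ a ≤ k − 1`, `j ≥ 1`): brick-wall steps, self-avoidance, lower half-plane,
columns in
`[0, X_L]` and `≥ 1` after time `0`, start and end on the wall, even length. [cite: EntingJensen2009, §7.4.2, Fig. 7.10]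
[cite: MadrasSlade1993, §1.2, Definition 1.2.4 (bridges, p. 11)] -/
theorem s2t_facts {k j a : ℕ} (ha : 1 ≤ a) (hak : a + 1 ≤ k) (hj : 1 ≤ j) :
    Tab.Facts (6 * k + 2 * j) (s2tX k j a) (s2tY k j a) := by
  refine ⟨fun t ht => ?_, fun t ht s hs hx hy => ?_, fun t ht => ?_, fun t ht => ?_, ?_, ?_, ?_, by omega,
    fun t ht h1 => ?_⟩
  · rw [adjE_iff_tda]
    rcases s2t_cases k j a t with ⟨h, x, y⟩ | ⟨l, h, x, y⟩ | ⟨l, h, x, y⟩ | ⟨l, h, x, y⟩ | ⟨l, x, y⟩ <;>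
      rcases s2t_cases k j a (t + 1) with
        ⟨h', x', y'⟩ | ⟨l', h', x', y'⟩ | ⟨l', h', x', y'⟩ | ⟨l', h', x', y'⟩ | ⟨l', x', y'⟩ <;>
        omega
  · rcases s2t_cases k j a t with ⟨h, x, y⟩ | ⟨l, h, x, y⟩ | ⟨l, h, x, y⟩ | ⟨l, h, x, y⟩ | ⟨l, x, y⟩ <;>
      rcases s2t_cases k j a s with
        ⟨h', x', y'⟩ | ⟨l', h', x', y'⟩ | ⟨l', h', x', y'⟩ | ⟨l', h', x', y'⟩ | ⟨l', x', y'⟩ <;>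
        omega
  · rcases s2t_cases k j a t with ⟨h, x, y⟩ | ⟨l, h, x, y⟩ | ⟨l, h, x, y⟩ | ⟨l, h, x, y⟩ | ⟨l, x, y⟩ <;> omega
  · have h0 := s2t_cases k j a 0
    have hL := s2t_cases k j a (6 * k + 2 * j)
    rcases s2t_cases k j a t with ⟨h, x, y⟩ | ⟨l, h, x, y⟩ | ⟨l, h, x, y⟩ | ⟨l, h, x, y⟩ | ⟨l, x, y⟩ <;> omega
  · have h0 := s2t_cases k j a 0; omega
  · have h0 := s2t_cases k j a 0; omega
  · have hL := s2t_cases k j a (6 * k + 2 * j); omega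
  · rcases s2t_cases k j a t with ⟨h, x, y⟩ | ⟨l, h, x, y⟩ | ⟨l, h, x, y⟩ | ⟨l, h, x, y⟩ | ⟨l, x, y⟩ <;> omega

/-- `s2t` is a positive wall bridge of length `m = 6k + 2j` (length symbolic). [cite: MadrasSlade1993, §1.2,
Definition 1.2.4 (p. 11)]
[cite: EntingJensen2009, §7.4.2, Fig. 7.10] -/
theorem s2t_mem_pwb {k j a m : ℕ} (ha : 1 ≤ a) (hak : a + 1 ≤ k) (hj : 1 ≤ j) (hm : m = 6 * k + 2 * j) :
    s2t k j a ∈ pwb m :=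
  mem_pwb_of_facts rfl (s2t_facts ha hak hj) hm

/-- Coordinates of `s2t` up to its length. [cite: EntingJensen2009, §7.4.2, Fig. 7.10] -/
theorem s2t_apply {k j a t : ℕ} (ht : t ≤ 6 * k + 2 * j) :
    s2t k j a t 0 = s2tX k j a t ∧ s2t k j a t 1 = s2tY k j a t :=
  tab_walk_apply ht

/-- **`s2t` is irreducible**: the interior visits of the initial wall run (times `t ≤ 2a`) are followed by the return
to column `2 ≤ t` at time
`4a + 1`, those of the final wall run are preceded by the bottom run's far end `2k + 2j > X_t` at time `4a + 2k + 2j`.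
[cite: MadrasSlade1993, §4.2, Definition 4.2.1 (p. 90)]
[cite: Kesten1963SAW, §4] [cite: EntingJensen2009, §7.4.2, Fig. 7.10] -/
theorem s2t_mem_ipwb {k j a m : ℕ} (ha : 1 ≤ a) (hak : a + 1 ≤ k) (hj : 1 ≤ j) (hm : m = 6 * k + 2 * j) :
    s2t k j a ∈ ipwb m := by
  refine mem_ipwb_of_facts_wit rfl (s2t_facts ha hak hj) hm (by omega) fun t ht1 ht2 hte hY => ?_
  rcases s2t_cases k j a t with ⟨h, x, y⟩ | ⟨l, h, x, y⟩ | ⟨l, h, x, y⟩ | ⟨l, h, x, y⟩ | ⟨l, x, y⟩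
  · refine Or.inl ⟨4 * a + 1, by omega, by omega, ?_⟩
    rcases s2t_cases k j a (4 * a + 1) with
      ⟨h', x', y'⟩ | ⟨l', h', x', y'⟩ | ⟨l', h', x', y'⟩ | ⟨l', h', x', y'⟩ | ⟨l', x', y'⟩ <;>
      omega
  · omega
  · omega
  · omega
  · refine Or.inr ⟨4 * a + 2 * k + 2 * j, by omega, by omega, ?_⟩
    rcases s2t_cases k j a (4 * a + 2 * k + 2 * j) with
      ⟨h', x', y'⟩ | ⟨l', h', x', y'⟩ | ⟨l', h', x', y'⟩ | ⟨l', h', x', y'⟩ | ⟨l', x', y'⟩ <;>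
      omega

/-- **`s2t` has `k` visits** (`a` on the initial wall run, `k − a` on the final one).
[cite: BeatonBousquetMelouDeGierDuminilCopinGuttmann2014, §3.1 (arXiv v5 p. 8)] [cite: EntingJensen2009, §7.4.2, Fig.
7.10] -/
theorem visits_s2t {k j a m : ℕ} (ha : 1 ≤ a) (hak : a + 1 ≤ k) (hj : 1 ≤ j) (hm : m = 6 * k + 2 * j) :
    visits m (s2t k j a) = k := by
  have hY : ∀ t, t ≤ 6 * k + 2 * j → s2t k j a t 1 = s2tY k j a t := fun t ht => (s2t_apply ht).2
  have h1 : visits (0 + (2 * a + 1)) (s2t k j a) = visits 0 (s2t k j a) + ((0 + (2 * a + 1)) / 2 - 0 / 2) :=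
    visits_add_of_wall fun q _ hq => by
      rw [hY _ (by omega)]
      rcases s2t_cases k j a (0 + q) with
        ⟨h', x', y'⟩ | ⟨l', h', x', y'⟩ | ⟨l', h', x', y'⟩ | ⟨l', h', x', y'⟩ | ⟨l', x', y'⟩ <;> omega
  have h2 : visits (2 * a + 1 + (4 * k + 2 * j - 1)) (s2t k j a) = visits (2 * a + 1) (s2t k j a) :=
    visits_add_eq_left fun q hq1 hq2 h => by
      obtain ⟨-, h0⟩ := h
      rw [hY _ (by omega)] at h0
      rcases s2t_cases k j a (2 * a + 1 + q) with
        ⟨h', x', y'⟩ | ⟨l', h', x', y'⟩ | ⟨l', h', x', y'⟩ | ⟨l', h', x', y'⟩ | ⟨l', x', y'⟩ <;> omega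
  have h3 : visits (2 * a + 4 * k + 2 * j + (2 * k - 2 * a)) (s2t k j a) =
      visits (2 * a + 4 * k + 2 * j) (s2t k j a) +
        ((2 * a + 4 * k + 2 * j + (2 * k - 2 * a)) / 2 - (2 * a + 4 * k + 2 * j) / 2) :=
    visits_add_of_wall fun q _ hq => by
      rw [hY _ (by omega)]
      rcases s2t_cases k j a (2 * a + 4 * k + 2 * j + q) with
        ⟨h', x', y'⟩ | ⟨l', h', x', y'⟩ | ⟨l', h', x', y'⟩ | ⟨l', h', x', y'⟩ | ⟨l', x', y'⟩ <;>
        omega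
  rw [zero_add, visits_zero, zero_add] at h1
  rw [show 2 * a + 1 + (4 * k + 2 * j - 1) = 2 * a + 4 * k + 2 * j by omega, h1] at h2
  rw [show 2 * a + 4 * k + 2 * j + (2 * k - 2 * a) = 6 * k + 2 * j by omega, h2] at h3
  subst hm
  rw [h3]
  omega

/-- **`s2t` has two down steps**, at the times `2 * a + 1` and `4 * a + 1`. [cite: EntingJensen2009, §7.4.2, Fig.
7.10] -/
theorem stepsD_s2t {k j a m : ℕ} (ha : 1 ≤ a) (hak : a + 1 ≤ k) (hj : 1 ≤ j) (hm : m = 6 * k + 2 * j) :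
    stepsD m (s2t k j a) = {2 * a + 1, 4 * a + 1} := by
  subst hm
  ext t
  simp only [stepsD, mem_filter, mem_range, mem_insert, mem_singleton]
  constructor
  · rintro ⟨ht, hx, hy⟩
    rw [(s2t_apply (t := t + 1) (by omega)).1, (s2t_apply (t := t) (by omega)).1] at hx
    rw [(s2t_apply (t := t + 1) (by omega)).2, (s2t_apply (t := t) (by omega)).2] at hy
    rcases s2t_cases k j a t with ⟨h, x, y⟩ | ⟨l, h, x, y⟩ | ⟨l, h, x, y⟩ | ⟨l, h, x, y⟩ | ⟨l, x, y⟩ <;>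
      rcases s2t_cases k j a (t + 1) with
        ⟨h', x', y'⟩ | ⟨l', h', x', y'⟩ | ⟨l', h', x', y'⟩ | ⟨l', h', x', y'⟩ | ⟨l', x', y'⟩ <;>
        omega
  · intro ht
    have ht4 : t + 1 ≤ 6 * k + 2 * j := by omega
    refine ⟨by omega, ?_, ?_⟩
    · rw [(s2t_apply ht4).1, (s2t_apply (t := t) (by omega)).1]
      rcases s2t_cases k j a t with ⟨h, x, y⟩ | ⟨l, h, x, y⟩ | ⟨l, h, x, y⟩ | ⟨l, h, x, y⟩ | ⟨l, x, y⟩ <;>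
        rcases s2t_cases k j a (t + 1) with
          ⟨h', x', y'⟩ | ⟨l', h', x', y'⟩ | ⟨l', h', x', y'⟩ | ⟨l', h', x', y'⟩ | ⟨l', x', y'⟩ <;>
          omega
    · rw [(s2t_apply ht4).2, (s2t_apply (t := t) (by omega)).2]
      rcases s2t_cases k j a t with ⟨h, x, y⟩ | ⟨l, h, x, y⟩ | ⟨l, h, x, y⟩ | ⟨l, h, x, y⟩ | ⟨l, x, y⟩ <;>
        rcases s2t_cases k j a (t + 1) with
          ⟨h', x', y'⟩ | ⟨l', h', x', y'⟩ | ⟨l', h', x', y'⟩ | ⟨l', h', x', y'⟩ | ⟨l', x', y'⟩ <;>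
          omega

/-! ### §3  Family H (`j + 1` blocks, directions `L R R`): `R^{2k−1} D L^{2k−3} D R^{2k−2+2i} U R^{2j+1−2i} U R` (`0 ≤
i ≤ j`), `X_n = 2k + 2j + 2` -/

/-- Column table of the H block with parameter `i` (`k ≥ 2`, `i ≤ j`, length `6k+2j`): wall run `(t,0)`, `t ≤ 2k−1`;
return run `(4k−1−t,−1)` back to column `2`;
bottom run `(t+4−4k,−2)` out to column `2k+2i`; row-`−1` run `(t+3−4k,−1)` out to column `2k+2j+1`; last step to
`(2k+2j+2, 0)` — the hook
staircase with its exit stretched by `2j` columns. [cite: EntingJensen2009, §7.4.2, Fig. 7.10 (brickwork form of the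
honeycomb lattice)] -/
def s2hX (k j i t : ℕ) : ℤ :=
  if t + 1 ≤ 2 * k then (t : ℤ)
  else if t + 3 ≤ 4 * k then 4 * (k : ℤ) - 1 - t
  else if t + 4 ≤ 6 * k + 2 * i then (t : ℤ) + 4 - 4 * k
  else if t + 2 ≤ 6 * k + 2 * j then (t : ℤ) + 3 - 4 * k
  else (t : ℤ) + 2 - 4 * k

/-- Height table of the H blocks. [cite: EntingJensen2009, §7.4.2, Fig. 7.10] -/
def s2hY (k j i t : ℕ) : ℤ :=
  if t + 1 ≤ 2 * k then 0
  else if t + 3 ≤ 4 * k then -1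
  else if t + 4 ≤ 6 * k + 2 * i then -2
  else if t + 2 ≤ 6 * k + 2 * j then -1
  else 0

/-- **The H block** `(0,0)→…→(2k−1,0)↓←…←(2,−1)↓(2,−2)→…→(2k+2i,−2)↑→…→(2k+2j+1,−1)↑(2k+2j+1,0)→(2k+2j+2,0)` of length
`6k+2j`
(`i ≤ j`; car 77's H blocks at `j = 2`). [cite: EntingJensen2009, §7.4.2, Fig. 7.10] -/
def s2h (k j i : ℕ) : ℕ → Site 2 := Tab.walk (6 * k + 2 * j) (s2hX k j i) (s2hY k j i)

/-- The five affine pieces of the tables of `s2h`, with their values. [cite: EntingJensen2009, §7.4.2, Fig. 7.10] -/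
private theorem s2h_cases (k j i t : ℕ) :
    (t + 1 ≤ 2 * k ∧ s2hX k j i t = (t : ℤ) ∧ s2hY k j i t = 0) ∨
      (2 * k ≤ t ∧ t + 3 ≤ 4 * k ∧ s2hX k j i t = 4 * (k : ℤ) - 1 - t ∧ s2hY k j i t = -1) ∨
      (4 * k ≤ t + 2 ∧ t + 4 ≤ 6 * k + 2 * i ∧ s2hX k j i t = (t : ℤ) + 4 - 4 * k ∧ s2hY k j i t = -2) ∨
      (6 * k + 2 * i ≤ t + 3 ∧ t + 2 ≤ 6 * k + 2 * j ∧ s2hX k j i t = (t : ℤ) + 3 - 4 * k ∧ s2hY k j i t = -1) ∨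
      (6 * k + 2 * j ≤ t + 1 ∧ s2hX k j i t = (t : ℤ) + 2 - 4 * k ∧ s2hY k j i t = 0) := by
  simp only [s2hX, s2hY]
  split_ifs <;> omega

/-- **Coordinate facts of `s2h`** (`k ≥ 2`, `i ≤ j`): brick-wall steps, self-avoidance, lower half-plane, columns in
`[0, X_L]` and `≥ 1` after time `0`, start and end on the wall, even length. [cite: EntingJensen2009, §7.4.2, Fig. 7.10]
[cite: MadrasSlade1993, §1.2, Definition 1.2.4 (bridges, p. 11)] -/
theorem s2h_facts {k j i : ℕ} (hk : 2 ≤ k) (hij : i ≤ j) : Tab.Facts (6 * k + 2 * j) (s2hX k j i) (s2hY k j i) := by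
  refine ⟨fun t ht => ?_, fun t ht s hs hx hy => ?_, fun t ht => ?_, fun t ht => ?_, ?_, ?_, ?_, by omega,
    fun t ht h1 => ?_⟩
  · rw [adjE_iff_tda]
    rcases s2h_cases k j i t with ⟨h, x, y⟩ | ⟨l, h, x, y⟩ | ⟨l, h, x, y⟩ | ⟨l, h, x, y⟩ | ⟨l, x, y⟩ <;>
      rcases s2h_cases k j i (t + 1) with
        ⟨h', x', y'⟩ | ⟨l', h', x', y'⟩ | ⟨l', h', x', y'⟩ | ⟨l', h', x', y'⟩ | ⟨l', x', y'⟩ <;>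
        omega
  · rcases s2h_cases k j i t with ⟨h, x, y⟩ | ⟨l, h, x, y⟩ | ⟨l, h, x, y⟩ | ⟨l, h, x, y⟩ | ⟨l, x, y⟩ <;>
      rcases s2h_cases k j i s with
        ⟨h', x', y'⟩ | ⟨l', h', x', y'⟩ | ⟨l', h', x', y'⟩ | ⟨l', h', x', y'⟩ | ⟨l', x', y'⟩ <;>
        omega
  · rcases s2h_cases k j i t with ⟨h, x, y⟩ | ⟨l, h, x, y⟩ | ⟨l, h, x, y⟩ | ⟨l, h, x, y⟩ | ⟨l, x, y⟩ <;> omega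
  · have h0 := s2h_cases k j i 0
    have hL := s2h_cases k j i (6 * k + 2 * j)
    rcases s2h_cases k j i t with ⟨h, x, y⟩ | ⟨l, h, x, y⟩ | ⟨l, h, x, y⟩ | ⟨l, h, x, y⟩ | ⟨l, x, y⟩ <;> omega
  · have h0 := s2h_cases k j i 0; omega
  · have h0 := s2h_cases k j i 0; omega
  · have hL := s2h_cases k j i (6 * k + 2 * j); omega
  · rcases s2h_cases k j i t with ⟨h, x, y⟩ | ⟨l, h, x, y⟩ | ⟨l, h, x, y⟩ | ⟨l, h, x, y⟩ | ⟨l, x, y⟩ <;> omega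

/-- `s2h` is a positive wall bridge of length `m = 6k + 2j` (length symbolic). [cite: MadrasSlade1993, §1.2,
Definition 1.2.4 (p. 11)]
[cite: EntingJensen2009, §7.4.2, Fig. 7.10] -/
theorem s2h_mem_pwb {k j i m : ℕ} (hk : 2 ≤ k) (hij : i ≤ j) (hm : m = 6 * k + 2 * j) : s2h k j i ∈ pwb m :=
  mem_pwb_of_facts rfl (s2h_facts hk hij) hm

/-- Coordinates of `s2h` up to its length. [cite: EntingJensen2009, §7.4.2, Fig. 7.10] -/
theorem s2h_apply {k j i t : ℕ} (ht : t ≤ 6 * k + 2 * j) :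
    s2h k j i t 0 = s2hX k j i t ∧ s2h k j i t 1 = s2hY k j i t :=
  tab_walk_apply ht

/-- **`s2h` is irreducible**: its interior visits (times `t ≤ 2k−2` of the wall run) are followed by the return to
column `2 ≤ t` at time `4k − 3`; the
final wall run is a single step. [cite: MadrasSlade1993, §4.2, Definition 4.2.1 (p. 90)]
[cite: Kesten1963SAW, §4] [cite: EntingJensen2009, §7.4.2, Fig. 7.10] -/
theorem s2h_mem_ipwb {k j i m : ℕ} (hk : 2 ≤ k) (hij : i ≤ j) (hm : m = 6 * k + 2 * j) : s2h k j i ∈ ipwb m := by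
  refine mem_ipwb_of_facts_wit rfl (s2h_facts hk hij) hm (by omega) fun t ht1 ht2 hte hY => ?_
  rcases s2h_cases k j i t with ⟨h, x, y⟩ | ⟨l, h, x, y⟩ | ⟨l, h, x, y⟩ | ⟨l, h, x, y⟩ | ⟨l, x, y⟩
  · refine Or.inl ⟨4 * k - 3, by omega, by omega, ?_⟩
    rcases s2h_cases k j i (4 * k - 3) with
      ⟨h', x', y'⟩ | ⟨l', h', x', y'⟩ | ⟨l', h', x', y'⟩ | ⟨l', h', x', y'⟩ | ⟨l', x', y'⟩ <;>
      omega
  · omega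
  · omega
  · omega
  · omega

/-- **`s2h` has `k` visits** (`k − 1` on the initial wall run and the endpoint).
[cite: BeatonBousquetMelouDeGierDuminilCopinGuttmann2014, §3.1 (arXiv v5 p. 8)] [cite: EntingJensen2009, §7.4.2, Fig.
7.10] -/
theorem visits_s2h {k j i m : ℕ} (hk : 2 ≤ k) (hij : i ≤ j) (hm : m = 6 * k + 2 * j) : visits m (s2h k j i) = k := by
  have hY : ∀ t, t ≤ 6 * k + 2 * j → s2h k j i t 1 = s2hY k j i t := fun t ht => (s2h_apply ht).2
  have h1 : visits (0 + (2 * k - 1)) (s2h k j i) = visits 0 (s2h k j i) + ((0 + (2 * k - 1)) / 2 - 0 / 2) :=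
    visits_add_of_wall fun q _ hq => by
      rw [hY _ (by omega)]
      rcases s2h_cases k j i (0 + q) with
        ⟨h', x', y'⟩ | ⟨l', h', x', y'⟩ | ⟨l', h', x', y'⟩ | ⟨l', h', x', y'⟩ | ⟨l', x', y'⟩ <;> omega
  have h2 : visits (2 * k - 1 + (4 * k + 2 * j - 1)) (s2h k j i) = visits (2 * k - 1) (s2h k j i) :=
    visits_add_eq_left fun q hq1 hq2 h => by
      obtain ⟨-, h0⟩ := h
      rw [hY _ (by omega)] at h0
      rcases s2h_cases k j i (2 * k - 1 + q) with
        ⟨h', x', y'⟩ | ⟨l', h', x', y'⟩ | ⟨l', h', x', y'⟩ | ⟨l', h', x', y'⟩ | ⟨l', x', y'⟩ <;> omega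
  have h3 : visits (6 * k + 2 * j - 2 + (2)) (s2h k j i) =
      visits (6 * k + 2 * j - 2) (s2h k j i) + ((6 * k + 2 * j - 2 + (2)) / 2 - (6 * k + 2 * j - 2) / 2) :=
    visits_add_of_wall fun q _ hq => by
      rw [hY _ (by omega)]
      rcases s2h_cases k j i (6 * k + 2 * j - 2 + q) with
        ⟨h', x', y'⟩ | ⟨l', h', x', y'⟩ | ⟨l', h', x', y'⟩ | ⟨l', h', x', y'⟩ | ⟨l', x', y'⟩ <;>
        omega
  rw [zero_add, visits_zero, zero_add] at h1
  rw [show 2 * k - 1 + (4 * k + 2 * j - 1) = 6 * k + 2 * j - 2 by omega, h1] at h2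
  rw [show 6 * k + 2 * j - 2 + (2) = 6 * k + 2 * j by omega, h2] at h3
  subst hm
  rw [h3]
  omega

/-- **`s2h` has two down steps**, at the times `2 * k - 1` and `4 * k - 3`. [cite: EntingJensen2009, §7.4.2, Fig.
7.10] -/
theorem stepsD_s2h {k j i m : ℕ} (hk : 2 ≤ k) (hij : i ≤ j) (hm : m = 6 * k + 2 * j) :
    stepsD m (s2h k j i) = {2 * k - 1, 4 * k - 3} := by
  subst hm
  ext t
  simp only [stepsD, mem_filter, mem_range, mem_insert, mem_singleton]
  constructor
  · rintro ⟨ht, hx, hy⟩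
    rw [(s2h_apply (t := t + 1) (by omega)).1, (s2h_apply (t := t) (by omega)).1] at hx
    rw [(s2h_apply (t := t + 1) (by omega)).2, (s2h_apply (t := t) (by omega)).2] at hy
    rcases s2h_cases k j i t with ⟨h, x, y⟩ | ⟨l, h, x, y⟩ | ⟨l, h, x, y⟩ | ⟨l, h, x, y⟩ | ⟨l, x, y⟩ <;>
      rcases s2h_cases k j i (t + 1) with
        ⟨h', x', y'⟩ | ⟨l', h', x', y'⟩ | ⟨l', h', x', y'⟩ | ⟨l', h', x', y'⟩ | ⟨l', x', y'⟩ <;>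
        omega
  · intro ht
    have ht4 : t + 1 ≤ 6 * k + 2 * j := by omega
    refine ⟨by omega, ?_, ?_⟩
    · rw [(s2h_apply ht4).1, (s2h_apply (t := t) (by omega)).1]
      rcases s2h_cases k j i t with ⟨h, x, y⟩ | ⟨l, h, x, y⟩ | ⟨l, h, x, y⟩ | ⟨l, h, x, y⟩ | ⟨l, x, y⟩ <;>
        rcases s2h_cases k j i (t + 1) with
          ⟨h', x', y'⟩ | ⟨l', h', x', y'⟩ | ⟨l', h', x', y'⟩ | ⟨l', h', x', y'⟩ | ⟨l', x', y'⟩ <;>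
          omega
    · rw [(s2h_apply ht4).2, (s2h_apply (t := t) (by omega)).2]
      rcases s2h_cases k j i t with ⟨h, x, y⟩ | ⟨l, h, x, y⟩ | ⟨l, h, x, y⟩ | ⟨l, h, x, y⟩ | ⟨l, x, y⟩ <;>
        rcases s2h_cases k j i (t + 1) with
          ⟨h', x', y'⟩ | ⟨l', h', x', y'⟩ | ⟨l', h', x', y'⟩ | ⟨l', h', x', y'⟩ | ⟨l', x', y'⟩ <;>
          omega

/-! ### §4  The `2j + k − 1` blocks are distinct: the two-down Finset at slack `2j` -/

/-- Two O blocks with `i < i'` differ at time `2i + 4` (row `−2` against row `−1`). [cite: EntingJensen2009, §7.4.2,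
Fig. 7.10] -/
private theorem s2o_ne_of_lt {k j i i' : ℕ} (h : i < i') (hi' : i' + 2 ≤ j) : s2o k j i ≠ s2o k j i' := by
  intro e
  have e1 := congrArg (fun w : ℕ → Site 2 => w (2 * i + 4) 1) e
  rw [(s2o_apply (by omega)).2, (s2o_apply (by omega)).2] at e1
  rcases s2o_cases k j i (2 * i + 4) with ⟨h, x, y⟩ | ⟨l, h, x, y⟩ | ⟨l, h, x, y⟩ | ⟨l, h, x, y⟩ | ⟨l, x, y⟩ <;>
    rcases s2o_cases k j i' (2 * i + 4) with
      ⟨h', x', y'⟩ | ⟨l', h', x', y'⟩ | ⟨l', h', x', y'⟩ | ⟨l', h', x', y'⟩ | ⟨l', x', y'⟩ <;>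
      omega

/-- Two T blocks with `a < a'` differ at time `2a + 2` (row `−1` against row `0`). [cite: EntingJensen2009, §7.4.2,
Fig. 7.10] -/
private theorem s2t_ne_of_lt {k j a a' : ℕ} (ha : 1 ≤ a) (h : a < a') (ha'k : a' + 1 ≤ k) : s2t k j a ≠ s2t k j a' := by
  intro e
  have e1 := congrArg (fun w : ℕ → Site 2 => w (2 * a + 2) 1) e
  rw [(s2t_apply (by omega)).2, (s2t_apply (by omega)).2] at e1
  rcases s2t_cases k j a (2 * a + 2) with ⟨h, x, y⟩ | ⟨l, h, x, y⟩ | ⟨l, h, x, y⟩ | ⟨l, h, x, y⟩ | ⟨l, x, y⟩ <;>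
    rcases s2t_cases k j a' (2 * a + 2) with
      ⟨h', x', y'⟩ | ⟨l', h', x', y'⟩ | ⟨l', h', x', y'⟩ | ⟨l', h', x', y'⟩ | ⟨l', x', y'⟩ <;>
      omega

/-- Two H blocks with `i < i'` differ at time `6k − 3 + 2i` (row `−1` against row `−2`). [cite: EntingJensen2009,
§7.4.2, Fig. 7.10] -/
private theorem s2h_ne_of_lt {k j i i' : ℕ} (hk : 2 ≤ k) (h : i < i') (hi' : i' ≤ j) : s2h k j i ≠ s2h k j i' := by
  intro e
  have e1 := congrArg (fun w : ℕ → Site 2 => w (6 * k - 3 + 2 * i) 1) e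
  rw [(s2h_apply (by omega)).2, (s2h_apply (by omega)).2] at e1
  rcases s2h_cases k j i (6 * k - 3 + 2 * i) with ⟨h, x, y⟩ | ⟨l, h, x, y⟩ | ⟨l, h, x, y⟩ | ⟨l, h, x, y⟩ | ⟨l, x, y⟩ <;>
    rcases s2h_cases k j i' (6 * k - 3 + 2 * i) with
      ⟨h', x', y'⟩ | ⟨l', h', x', y'⟩ | ⟨l', h', x', y'⟩ | ⟨l', h', x', y'⟩ | ⟨l', x', y'⟩ <;>
      omega

/-- An O block ends in column `2k + 2j − 2`, a T block in column `2k + 2j`. [cite: EntingJensen2009, §7.4.2, Fig.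
7.10] -/
private theorem s2o_ne_s2t {k j i a : ℕ} (hak : a + 1 ≤ k) : s2o k j i ≠ s2t k j a := by
  intro e
  have e1 := congrArg (fun w : ℕ → Site 2 => w (6 * k + 2 * j) 0) e
  rw [(s2o_apply le_rfl).1, (s2t_apply le_rfl).1] at e1
  have h1 := s2o_cases k j i (6 * k + 2 * j)
  have h2 := s2t_cases k j a (6 * k + 2 * j)
  omega

/-- An O block ends in column `2k + 2j − 2`, an H block in column `2k + 2j + 2`. [cite: EntingJensen2009, §7.4.2, Fig.
7.10] -/
private theorem s2o_ne_s2h {k j i i' : ℕ} : s2o k j i ≠ s2h k j i' := by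
  intro e
  have e1 := congrArg (fun w : ℕ → Site 2 => w (6 * k + 2 * j) 0) e
  rw [(s2o_apply le_rfl).1, (s2h_apply le_rfl).1] at e1
  have h1 := s2o_cases k j i (6 * k + 2 * j)
  have h2 := s2h_cases k j i' (6 * k + 2 * j)
  omega

/-- A T block ends in column `2k + 2j`, an H block in column `2k + 2j + 2`. [cite: EntingJensen2009, §7.4.2, Fig.
7.10] -/
private theorem s2t_ne_s2h {k j a i : ℕ} (hak : a + 1 ≤ k) : s2t k j a ≠ s2h k j i := by
  intro e
  have e1 := congrArg (fun w : ℕ → Site 2 => w (6 * k + 2 * j) 0) e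
  rw [(s2t_apply le_rfl).1, (s2h_apply le_rfl).1] at e1
  have h1 := s2t_cases k j a (6 * k + 2 * j)
  have h2 := s2h_cases k j i (6 * k + 2 * j)
  omega

open Classical in
/-- The `j − 1` O blocks (`i = 0, …, j − 2`). [cite: EntingJensen2009, §7.4.2, Fig. 7.10] -/
noncomputable def s2oBlocks (k j : ℕ) : Finset (ℕ → Site 2) := (range (j - 1)).image (s2o k j)

open Classical in
/-- The `k − 1` T blocks (hairpin parameter `a = 1, …, k − 1`). [cite: EntingJensen2009, §7.4.2, Fig. 7.10] -/
noncomputable def s2tBlocks (k j : ℕ) : Finset (ℕ → Site 2) := (range (k - 1)).image fun a => s2t k j (a + 1)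

open Classical in
/-- The `j + 1` H blocks (`i = 0, …, j`). [cite: EntingJensen2009, §7.4.2, Fig. 7.10] -/
noncomputable def s2hBlocks (k j : ℕ) : Finset (ℕ → Site 2) := (range (j + 1)).image (s2h k j)

open Classical in
/-- **The two-down Finset at slack `2j`**: the O, T and H blocks of length `6k + 2j`.
[cite: EntingJensen2009, §7.4.2, Fig. 7.10] [cite: MadrasSlade1993, §4.2, Definition 4.2.1 (p. 90)] -/
noncomputable def twoDownBlocksS (k j : ℕ) : Finset (ℕ → Site 2) := s2oBlocks k j ∪ s2tBlocks k j ∪ s2hBlocks k j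

open Classical in
/-- `#s2oBlocks k j = j − 1`. [cite: EntingJensen2009, §7.4.2, Fig. 7.10] -/
theorem card_s2oBlocks (k j : ℕ) : #(s2oBlocks k j) = j - 1 := by
  rw [s2oBlocks, card_image_of_injOn, card_range]
  intro i hi i' hi' e
  simp only [coe_range, Set.mem_Iio] at hi hi'
  by_contra hne
  rcases Nat.lt_or_gt_of_ne hne with h | h
  · exact s2o_ne_of_lt h (by omega) e
  · exact s2o_ne_of_lt h (by omega) e.symm

open Classical in
/-- `#s2tBlocks k j = k − 1`. [cite: EntingJensen2009, §7.4.2, Fig. 7.10] -/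
theorem card_s2tBlocks (k j : ℕ) : #(s2tBlocks k j) = k - 1 := by
  rw [s2tBlocks, card_image_of_injOn, card_range]
  intro a ha a' ha' e
  simp only [coe_range, Set.mem_Iio] at ha ha'
  by_contra hne
  rcases Nat.lt_or_gt_of_ne hne with h | h
  · exact s2t_ne_of_lt (by omega) (by omega) (by omega) e
  · exact s2t_ne_of_lt (by omega) (by omega) (by omega) e.symm

open Classical in
/-- `#s2hBlocks k j = j + 1` (`k ≥ 2`). [cite: EntingJensen2009, §7.4.2, Fig. 7.10] -/
theorem card_s2hBlocks {k : ℕ} (hk : 2 ≤ k) (j : ℕ) : #(s2hBlocks k j) = j + 1 := by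
  rw [s2hBlocks, card_image_of_injOn, card_range]
  intro i hi i' hi' e
  simp only [coe_range, Set.mem_Iio] at hi hi'
  by_contra hne
  rcases Nat.lt_or_gt_of_ne hne with h | h
  · exact s2h_ne_of_lt hk h (by omega) e
  · exact s2h_ne_of_lt hk h (by omega) e.symm

open Classical in
/-- ★★ **The two-down Finset at slack `2j` has `2j + k − 1` elements** (`k ≥ 2`, `j ≥ 1`): `(j − 1) + (k − 1) + (j +
1)`.
[cite: EntingJensen2009, §7.4.2, Fig. 7.10] [cite: MadrasSlade1993, §4.2, Definition 4.2.1 (p. 90)] -/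
theorem card_twoDownBlocksS {k j : ℕ} (hk : 2 ≤ k) (hj : 1 ≤ j) : #(twoDownBlocksS k j) = 2 * j + k - 1 := by
  have hd1 : Disjoint (s2oBlocks k j) (s2tBlocks k j) := by
    refine disjoint_left.2 fun ω h1 h2 => ?_
    simp only [s2oBlocks, s2tBlocks, mem_image, mem_range] at h1 h2
    obtain ⟨i, hi, rfl⟩ := h1
    obtain ⟨a, ha, e⟩ := h2
    exact s2o_ne_s2t (by omega) e.symm
  have hd2 : Disjoint (s2oBlocks k j ∪ s2tBlocks k j) (s2hBlocks k j) := by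
    refine disjoint_left.2 fun ω h1 h2 => ?_
    simp only [mem_union, s2oBlocks, s2tBlocks, s2hBlocks, mem_image, mem_range] at h1 h2
    obtain ⟨i', hi', e'⟩ := h2
    rcases h1 with ⟨i, hi, rfl⟩ | ⟨a, ha, rfl⟩
    · exact s2o_ne_s2h e'.symm
    · exact s2t_ne_s2h (by omega) e'.symm
  rw [twoDownBlocksS, card_union_of_disjoint hd2, card_union_of_disjoint hd1, card_s2oBlocks, card_s2tBlocks,
    card_s2hBlocks hk]
  omega

open Classical in
/-- ★★ **Every element of the two-down Finset is an irreducible positive wall bridge of length `6k + 2j` with exactly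
`k` visits and
exactly two down steps** (`k ≥ 2`, `j ≥ 1`, length symbolic). [cite: MadrasSlade1993, §4.2, Definition 4.2.1 (p. 90)]
[cite: Kesten1963SAW, §4] [cite: BeatonBousquetMelouDeGierDuminilCopinGuttmann2014, §3.1 (arXiv v5 p. 8)] -/
theorem twoDownBlocksS_subset {k j m : ℕ} (hk : 2 ≤ k) (hj : 1 ≤ j) (hm : m = 6 * k + 2 * j) :
    twoDownBlocksS k j ⊆ (ipwb m).filter fun ω => visits m ω = k ∧ #(stepsD m ω) = 2 := by
  intro ω hω
  rw [mem_filter]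
  simp only [twoDownBlocksS, s2oBlocks, s2tBlocks, s2hBlocks, mem_union, mem_image, mem_range] at hω
  rcases hω with (⟨i, hi, rfl⟩ | ⟨a, ha, rfl⟩) | ⟨i, hi, rfl⟩
  · exact ⟨s2o_mem_ipwb (by omega) (by omega) hm, visits_s2o (by omega) (by omega) hm,
      by rw [stepsD_s2o (by omega) (by omega) hm]; exact card_pair (by omega)⟩
  · exact ⟨s2t_mem_ipwb (by omega) (by omega) hj hm, visits_s2t (by omega) (by omega) hj hm,
      by rw [stepsD_s2t (by omega) (by omega) hj hm]; exact card_pair (by omega)⟩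
  · exact ⟨s2h_mem_ipwb hk (by omega) hm, visits_s2h hk (by omega) hm,
      by rw [stepsD_s2h hk (by omega) hm]; exact card_pair (by omega)⟩

/-- ★★ **Lower bound at every slack**: for `k ≥ 2` and `j ≥ 1` there are at least `2j + k − 1` irreducible positive
wall bridges of
length `6k + 2j` with `k` visits and two down steps (`k + 1` at slack two, `k + 3` at slack four, `k + 5` at slack
six, …).
[cite: MadrasSlade1993, §4.2, Definition 4.2.1 (p. 90), (4.2.2)] [cite: EntingJensen2009, §7.4.2, Fig. 7.10] -/
theorem le_card_filter_visits_two_down {k j m : ℕ} (hk : 2 ≤ k) (hj : 1 ≤ j) (hm : m = 6 * k + 2 * j) :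
    2 * j + k - 1 ≤ #((ipwb m).filter fun ω => visits m ω = k ∧ #(stepsD m ω) = 2) := by
  classical
  rw [← card_twoDownBlocksS hk hj]
  exact card_le_card (twoDownBlocksS_subset hk hj hm)

end Literature.Probability.RandomPlanarGeometry.SAW.HexBW.Wall
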